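import Literature.NumberTheory.Sieve.MontgomeryVaughan1975DensityProofs
import Literature.NumberTheory.Sieve.PrimesInAPGallagherRange
import Literature.NumberTheory.Sieve.MontgomeryVaughan1975Lemma43PrimeSums
import Literature.NumberTheory.LFunctions.SiegelExceptionalZeroBound
import HarnessLib

/-!
# Linnik's theorem: the least prime in an arithmetic progression is `≤ C q^L`

Topic `Literature/NumberTheory/Sieve`. THEOREMS only (no definition, no named fact, no `sorry`).
Reproduction of published work: Yu. V. Linnik, *On the least prime in an arithmetic progression.
I. The basic theorem; II. The Deuring–Heilbronn phenomenon*, Rec. Math. [Mat. Sbornik] N.S. 15 (57)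
(1944), 139–178 and 347–368: **there are absolute constants `C, L` such that for every `q ≥ 1` and
every `a` coprime to `q` the least prime `p ≡ a (mod q)` satisfies `p ≤ C q^L`.**

The proof is the classical one through the three principles (log-free zero density, the zero-free
region with Landau–Page, the Deuring–Heilbronn phenomenon), all theorems of the tree, in the
packaged form of Gallagher's prime number theorem — Montgomery–Vaughan's LEMMA 4.3
(`MontgomeryVaughan1975.lemma43_gallagher`, Gallagher, Invent. Math. 11 (1970), Theorem 7, DISCHARGED
in the tree as `MontgomeryVaughan1975.lemma43_gallagher_holds`, `MontgomeryVaughan1975DensityProofs.lean`)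
read at `x = h = N`:

* if no exceptional zero occurs at level `P` (`q ≤ P`), then
  `∑_{χ mod q} ‖∑_{p ≤ N} χ⋆(p) log p − [χ = χ₀] N‖ ≤ 2NK e^{−c₃ log N/log P}`;
* if the exceptional zero `β̃` of `χ̃` mod `r̃ ≤ P` occurs, the same holds with the term of the
  character induced by `χ̃` (there is at most one mod `q`) corrected by `+∑_{n ≤ N} n^{β̃−1}` and the
  right-hand side multiplied by `(1 − β̃) log P`.

Orthogonality (`φ(q) θ(N; q, a) = ∑_χ χ̄(a) ∑_{p ≤ N} χ(p) log p`), the passage to primitive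
characters (`PrimesInAPGallagher.norm_sub_charPrimeSum_le`, cost `≤ φ(q) log q`), and in the
exceptional case the main term `N − χ̃(a) ∑_{n ≤ N} n^{β̃−1} ≥ (N/4) min(1, (1 − β̃) log N) − 1/β̃`
(`sub_mul_rpow_div_ge`; `|∑_{n≤N} n^{β−1} − N^β/β| ≤ 1/β`), with `1 − β̃ ≥ C'/P` (Siegel's theorem
`Siegel.exists_one_sub_realZero_ge` for the quadratic `χ̃`, Landau–Page
`MontgomeryVaughan1975.exists_exceptionalZero_unique` otherwise), give `θ(N; q, a) > 0` for
`P = max(q, P₀)` and `P^A ≤ N ≤ 2P^A`.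

Main results:
* `Linnik.theta_pos_of_lemma43` — `θ(N; q, a) > 0` in that range, from `lemma43_gallagher`;
* `Linnik.exists_prime_le_of_lemma43`, `Linnik.linnik_of_lemma43` — Linnik's theorem from
  `lemma43_gallagher` (real, resp. natural constants);
* `Literature.NumberTheory.Sieve.linnik_leastPrimeAP` — **Linnik's theorem**, unconditional:
  `∃ L C : ℕ, ∀ q ≥ 1, ∀ a, a.Coprime q → ∃ p prime, p ≡ a [MOD q] ∧ p ≤ C q^L` (the displayed
  hypothesis `hLin` of `Summits/ABC/…/EisensteinQuarantineFalseOfProthDepthFamily.lean`);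
  `linnik_leastPrimeAP_real` — the same with real constants.

## References

* [Linnik1944] Yu. V. Linnik, Mat. Sb. 15 (57) (1944), 139–178; 347–368.
* [Gallagher1970Density] P. X. Gallagher, Invent. Math. 11 (1970) 329–339, Theorem 7 and §5.
* [MontgomeryVaughanActa1975] H. L. Montgomery, R. C. Vaughan, Acta Arith. 27 (1975), §4 Lemma 4.3.
* [Bombieri1987GrandCrible] E. Bombieri, Astérisque 18 (1987), §6, "Preuve du Théorème de Linnik",
  pp. 54–55.
* [IwaniecKowalski2004] H. Iwaniec, E. Kowalski, *Analytic Number Theory*, Thm. 18.1 and §18.4.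
-/

noncomputable section

open Finset Real

namespace Literature.NumberTheory.Sieve

namespace Linnik

open MontgomeryVaughan1975 PrimesInAPGallagher Literature.NumberTheory.LFunctions

/-! ### Real-variable lemmas -/

-- adapted (hypothesis `log x ≥ 16` weakened to `≥ 8`) from Summits/QuantumAdvantage/QuantumAdvantage/
--   Theorems/LinnikCubicClassGroupsDegreeOnePrimesEscapeClassPNTDHLinnik.lean (`sub_mul_rpow_div_ge`)
/-- **The main term `x − r x^β/β` is at least `(x/4)·min(1, (1 − β) log x)`** for `|r| ≤ 1`,
`3/4 ≤ β < 1` and `log x ≥ 8` (`x^β = x e^{−t}`, `t = (1 − β) log x`, `e^{−t} ≤ 1/(1 + t)`; the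
Summits version asks `log x ≥ 16`). [folklore] -/
theorem sub_mul_rpow_div_ge {x β r : ℝ} (hx : 1 < x) (hL : 8 ≤ Real.log x) (hβ : 3 / 4 ≤ β)
    (hβ1 : β < 1) (hr : |r| ≤ 1) :
    x / 4 * min 1 ((1 - β) * Real.log x) ≤ x - r * x ^ β / β := by
  have hx0 : 0 < x := by linarith
  have hβ0 : 0 < β := by linarith
  set L : ℝ := Real.log x with hL'
  set t : ℝ := (1 - β) * L with ht
  have hδ0 : 0 < 1 - β := by linarith
  have ht0 : 0 < t := mul_pos hδ0 (by linarith)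
  set e : ℝ := Real.exp (-t) with he'
  have he0 : 0 < e := Real.exp_pos _
  have hxβ : x ^ β = x * e := by
    rw [he', Real.rpow_def_of_pos hx0, ← hL', show L * β = L + -t by rw [ht]; ring, Real.exp_add,
      Real.exp_log hx0]
  have het : e * (1 + t) ≤ 1 := by
    have h1 : 1 + t ≤ Real.exp t := by linarith [Real.add_one_le_exp t]
    have h2 : e * Real.exp t = 1 := by rw [he', ← Real.exp_add]; simp
    nlinarith [mul_le_mul_of_nonneg_left h1 he0.le]
  have hr1 : r ≤ 1 := (abs_le.1 hr).2
  have h1 : r * x ^ β / β ≤ x ^ β / β := by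
    refine div_le_div_of_nonneg_right ?_ hβ0.le
    have := Real.rpow_pos_of_pos hx0 β
    nlinarith
  set m : ℝ := min 1 t with hm
  have hkey : 1 ≤ (1 + t) * β * (1 - m / 4) := by
    rcases le_or_gt 1 t with h1t | ht1
    · rw [hm, min_eq_left h1t]
      nlinarith
    · rw [hm, min_eq_right ht1.le]
      have hβt : 1 - t / 8 ≤ β := by
        have : (1 - β) * 8 ≤ (1 - β) * L := mul_le_mul_of_nonneg_left hL hδ0.le
        rw [← ht] at this; linarith
      have htt : t ^ 2 ≤ t := by nlinarith
      have hA : 1 + t / 2 ≤ (1 + t) * (1 - t / 4) := by nlinarith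
      have hB : 1 ≤ (1 + t / 2) * (1 - t / 8) := by nlinarith
      have hC : (1 + t / 2) * (1 - t / 8) ≤ (1 + t) * (1 - t / 4) * (1 - t / 8) :=
        mul_le_mul_of_nonneg_right hA (by linarith)
      have hD : (1 + t) * (1 - t / 4) * (1 - t / 8) ≤ (1 + t) * (1 - t / 4) * β :=
        mul_le_mul_of_nonneg_left hβt (by nlinarith)
      nlinarith
  have hm1 : m ≤ 1 := min_le_left _ _
  have hm0 : 0 < m := lt_min one_pos ht0
  have heβ : e ≤ β * (1 - m / 4) := by
    have h0 : 0 ≤ β * (1 - m / 4) := by nlinarith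
    have := het.trans hkey
    nlinarith
  have hfin : x / 4 * m ≤ x - x ^ β / β := by
    rw [hxβ]
    have h2 : x * e / β ≤ x * (1 - m / 4) := by
      rw [div_le_iff₀ hβ0]
      have := mul_le_mul_of_nonneg_left heβ hx0.le
      linarith
    linarith
  exact hfin.trans (by linarith)

/-- **The exceptional correction is `N^β/β` up to `1/β`**: for `N ≥ 1` and `0 < β ≤ 1`,
`|∑_{0 < n ≤ N} n^{β−1} − N^β/β| ≤ 1/β` (sum versus integral for the decreasing `t ↦ t^{β−1}`,
`MontgomeryVaughan1975.abs_sum_rpow_sub_integral_le` on `(1, N]` plus the term `n = 1`). [folklore] -/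
theorem abs_sum_rpow_sub_div_le {N : ℕ} (hN : 1 ≤ N) {β : ℝ} (hβ0 : 0 < β) (hβ : β ≤ 1) :
    |∑ n ∈ Ioc 0 N, (n : ℝ) ^ (β - 1) - (N : ℝ) ^ β / β| ≤ 1 / β := by
  have h := abs_sum_rpow_sub_integral_le (y := 1) (x := N) le_rfl hN hβ0 hβ
  have hsplit : ∑ n ∈ Ioc 0 N, (n : ℝ) ^ (β - 1) = 1 + ∑ n ∈ Ioc 1 N, (n : ℝ) ^ (β - 1) := by
    have h01 : Ioc 0 N = insert 1 (Ioc 1 N) := by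
      ext n; simp only [Finset.mem_Ioc, Finset.mem_insert]; omega
    rw [h01, Finset.sum_insert (by simp), Nat.cast_one, Real.one_rpow]
  rw [hsplit]
  simp only [Nat.cast_one, Real.one_rpow] at h
  have h1β : 1 ≤ 1 / β := by rw [le_div_iff₀ hβ0]; linarith
  rw [abs_le] at h ⊢
  constructor
  · have : (1 : ℝ) + ∑ n ∈ Ioc 1 N, (n : ℝ) ^ (β - 1) - (N : ℝ) ^ β / β =
        (∑ n ∈ Ioc 1 N, (n : ℝ) ^ (β - 1) - ((N : ℝ) ^ β - 1) / β) + (1 - 1 / β) := by ring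
    rw [this]; linarith
  · have : (1 : ℝ) + ∑ n ∈ Ioc 1 N, (n : ℝ) ^ (β - 1) - (N : ℝ) ^ β / β =
        (∑ n ∈ Ioc 1 N, (n : ℝ) ^ (β - 1) - ((N : ℝ) ^ β - 1) / β) + (1 - 1 / β) := by ring
    rw [this]; linarith

/-! ### Characters mod `q`: orthogonality for the class `a`, and the exceptional inducer -/

/-- **Orthogonality for the class `a`**: for a unit `a` of `ZMod q`,
`∑_{χ mod q} χ(a⁻¹) ∑_{p ≤ N} χ(p) log p = φ(q) · ∑_{p ≤ N, p ≡ a (q)} log p`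
(Mathlib's `DirichletCharacter.sum_char_inv_mul_char_eq`). [folklore] -/
theorem sum_char_inv_mul_sum_eq {q : ℕ} [NeZero q] {a : ZMod q} (ha : IsUnit a) (N : ℕ) :
    ∑ χ : DirichletCharacter ℂ q, χ a⁻¹ * ∑ p ∈ (Ioc 0 N).filter Nat.Prime,
        χ (p : ZMod q) * (Real.log p : ℂ) =
      (q.totient : ℂ) * ((∑ p ∈ ((Ioc 0 N).filter Nat.Prime).filter
        (fun p : ℕ => (p : ZMod q) = a), Real.log p : ℝ) : ℂ) := by
  classical
  simp_rw [Finset.mul_sum]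
  rw [Finset.sum_comm]
  have : ∀ p ∈ (Ioc 0 N).filter Nat.Prime,
      ∑ χ : DirichletCharacter ℂ q, χ a⁻¹ * (χ (p : ZMod q) * (Real.log p : ℂ)) =
        if (p : ZMod q) = a then (q.totient : ℂ) * (Real.log p : ℂ) else 0 := by
    intro p _
    simp_rw [← mul_assoc]
    rw [← Finset.sum_mul, DirichletCharacter.sum_char_inv_mul_char_eq ℂ ha]
    by_cases h : (p : ZMod q) = a
    · rw [if_pos h.symm, if_pos h]
    · rw [if_neg (Ne.symm h), if_neg h, zero_mul]
  rw [Finset.sum_congr rfl this, ← Finset.sum_filter]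
  push_cast
  rw [Finset.mul_sum]

/-- A character `χ` mod `q` whose primitive inducer `χ⋆` (mod its conductor `f`) is the given
character `χ̃` mod `r` (`f = r` and `χ⋆(n) = χ̃(n)` for all `n`) is determined:
`χ(n) = χ̃(n)` for `n` coprime to `q` and `χ(n) = 0` otherwise. Hence at most one character mod `q`
is induced by `χ̃`. [folklore] -/
theorem card_filter_inducedBy_le_one {q r : ℕ} [NeZero q] (χe : DirichletCharacter ℂ r)
    (D : DecidablePred fun χ : DirichletCharacter ℂ q =>
      χ.conductor = r ∧ ∀ n : ℕ, χ.primitiveCharacter (n : ZMod χ.conductor) = χe (n : ZMod r)) :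
    (@Finset.filter _ (fun χ : DirichletCharacter ℂ q =>
      χ.conductor = r ∧ ∀ n : ℕ, χ.primitiveCharacter (n : ZMod χ.conductor) = χe (n : ZMod r))
        D univ).card ≤ 1 := by
  classical
  -- values of an induced character
  have hval : ∀ χ : DirichletCharacter ℂ q,
      (χ.conductor = r ∧ ∀ n : ℕ, χ.primitiveCharacter (n : ZMod χ.conductor) = χe (n : ZMod r)) →
        ∀ n : ℕ, χ (n : ZMod q) = if n.Coprime q then χe (n : ZMod r) else 0 := by
    rintro χ ⟨-, hn⟩ n
    split_ifs with hc
    · rw [← hn n]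
      have := χ.primitiveCharacter_apply_of_isCoprime (Nat.isCoprime_iff_coprime.mpr hc)
      push_cast at this
      exact this.symm
    · exact MulChar.map_nonunit χ (mt (ZMod.isUnit_iff_coprime n q).mp hc)
  refine Finset.card_le_one.mpr fun χ₁ h₁ χ₂ h₂ => ?_
  rw [Finset.mem_filter] at h₁ h₂
  apply MulChar.ext'
  intro x
  have hx : ((x.val : ℕ) : ZMod q) = x := ZMod.natCast_zmod_val x
  rw [← hx, hval χ₁ h₁.2, hval χ₂ h₂.2]

/-! ### Lemma 4.3 per modulus, both cases -/

open scoped Classical in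
/-- **Gallagher's prime number theorem per modulus, at `x = h = N`** (from `lemma43_gallagher`):
there are `c₁, c₃, c₄ > 0`, `K ≥ 1` such that for `N ≥ 1`, `exp(log^{1/2} N) ≤ P ≤ N^{c₄}`, `P ≥ 1`
and every modulus `q ≤ P`: EITHER no exceptional zero occurs at level `(c₁, P)` and
`∑_{χ mod q} ‖∑#_{p ≤ N} χ⋆(p) log p‖ ≤ 2NK e^{−c₃ log N/log P}`, OR an exceptional zero
`(r̃, χ̃, β̃)` occurs and the corrected terms satisfy
`∑_{χ mod q} ‖∑#̃ χ⋆‖ ≤ 2NK ((1 − β̃) log P) e^{−c₃ log N/log P}` (the characters mod `q` embed into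
the primitive characters of conductor `≤ P`, `PrimesInAPGallagher.sum_conductor_primitiveCharacter_le`).
[cite: MontgomeryVaughanActa1975, §4 Lemma 4.3 (4.2)] [cite: Gallagher1970Density, Theorem 7] -/
theorem sum_norm_gallagherTerm_le_or (h43 : lemma43_gallagher) :
    ∃ c₁ : ℝ, 0 < c₁ ∧ ∃ c₃ : ℝ, 0 < c₃ ∧ ∃ c₄ : ℝ, 0 < c₄ ∧ ∃ K : ℝ, 1 ≤ K ∧
      ∀ (N : ℕ) (P : ℝ), 1 ≤ N → Real.exp (Real.sqrt (Real.log N)) ≤ P → P ≤ (N : ℝ) ^ c₄ →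
        1 ≤ P → ∀ (q : ℕ) [NeZero q], (q : ℝ) ≤ P →
          ((∀ (r : ℕ) [NeZero r] (χ : DirichletCharacter ℂ r) (β : ℝ), ¬ IsExceptionalZero c₁ P r χ β) ∧
            ∑ χ : DirichletCharacter ℂ q, ‖gallagherTerm χ.primitiveCharacter N N‖ ≤
              2 * N * K * Real.exp (-c₃ * Real.log N / Real.log P)) ∨
          ∃ (r : ℕ) (_ : NeZero r) (χe : DirichletCharacter ℂ r) (β : ℝ),
            IsExceptionalZero c₁ P r χe β ∧
            ∑ χ : DirichletCharacter ℂ q, ‖gallagherTermExc χe β χ.primitiveCharacter N N‖ ≤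
              2 * N * K * ((1 - β) * Real.log P) * Real.exp (-c₃ * Real.log N / Real.log P) := by
  obtain ⟨c₁, hc₁, c₃, hc₃, c₄, hc₄, C, h⟩ := h43
  refine ⟨c₁, hc₁, c₃, hc₃, c₄, hc₄, max C 1, le_max_right _ _, ?_⟩
  intro N P hN hP1 hP2 hP3 q _ hqP
  obtain ⟨hA, hB⟩ := h N P hP1 hP2 (fun _ _ => N) (fun _ _ => N) (fun _ _ => le_rfl)
    (fun _ _ => le_rfl)
  set E : ℝ := Real.exp (-c₃ * Real.log N / Real.log P) with hE
  have hE0 : 0 < E := Real.exp_pos _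
  have hN0 : (0 : ℝ) < N := by exact_mod_cast hN
  have hNP : 0 < (N : ℝ) + N / P := by positivity
  have hNP2 : (N : ℝ) + N / P ≤ 2 * N := by
    have : (N : ℝ) / P ≤ N := div_le_self hN0.le hP3
    linarith
  have hC : C ≤ max C 1 := le_max_left _ _
  by_cases hex : ∃ (r : ℕ) (_ : NeZero r) (χe : DirichletCharacter ℂ r) (β : ℝ),
      IsExceptionalZero c₁ P r χe β
  · obtain ⟨r, hr, χe, β, hexc⟩ := hex
    refine Or.inr ⟨r, hr, χe, β, hexc, ?_⟩
    have hB' := hB r χe β hexc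
    have hemb := sum_conductor_primitiveCharacter_le hqP
      (fun q ψ => ((N : ℝ) + N / P)⁻¹ * ‖gallagherTermExc χe β ψ N N‖)
      (fun q ψ => by positivity) (fun q => inferInstance)
    have hbound : ∑ χ : DirichletCharacter ℂ q,
        ((N : ℝ) + N / P)⁻¹ * ‖gallagherTermExc χe β χ.primitiveCharacter N N‖ ≤
          C * ((1 - β) * Real.log P) * E := by
      refine hemb.trans ?_
      convert hB' using 2
    have hβ : 0 ≤ (1 - β) * Real.log P := by
      obtain ⟨-, -, -, -, hβ1, -⟩ := hexc
      exact mul_nonneg (by linarith) (Real.log_nonneg hP3)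
    have hsum : ∑ χ : DirichletCharacter ℂ q, ‖gallagherTermExc χe β χ.primitiveCharacter N N‖ =
        ((N : ℝ) + N / P) * ∑ χ : DirichletCharacter ℂ q,
          ((N : ℝ) + N / P)⁻¹ * ‖gallagherTermExc χe β χ.primitiveCharacter N N‖ := by
      rw [Finset.mul_sum]
      refine Finset.sum_congr rfl fun χ _ => ?_
      rw [← mul_assoc, mul_inv_cancel₀ hNP.ne', one_mul]
    rw [hsum]
    have hmax0 : 0 ≤ max C 1 * ((1 - β) * Real.log P) * E :=
      mul_nonneg (mul_nonneg (le_trans zero_le_one (le_max_right C 1)) hβ) hE0.le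
    calc ((N : ℝ) + N / P) * _ ≤ ((N : ℝ) + N / P) * (C * ((1 - β) * Real.log P) * E) :=
          mul_le_mul_of_nonneg_left hbound hNP.le
      _ ≤ ((N : ℝ) + N / P) * (max C 1 * ((1 - β) * Real.log P) * E) :=
          mul_le_mul_of_nonneg_left
            (mul_le_mul_of_nonneg_right (mul_le_mul_of_nonneg_right hC hβ) hE0.le) hNP.le
      _ ≤ (2 * N) * (max C 1 * ((1 - β) * Real.log P) * E) :=
          mul_le_mul_of_nonneg_right hNP2 hmax0
      _ = 2 * N * max C 1 * ((1 - β) * Real.log P) * E := by ring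
  · push Not at hex
    have hex' : ∀ (r : ℕ) [NeZero r] (χ : DirichletCharacter ℂ r) (β : ℝ),
        ¬ IsExceptionalZero c₁ P r χ β := fun r _ χ β hx => hex r inferInstance χ β hx
    refine Or.inl ⟨hex', ?_⟩
    have hA' := hA hex'
    have hemb := sum_conductor_primitiveCharacter_le hqP
      (fun q ψ => ((N : ℝ) + N / P)⁻¹ * ‖gallagherTerm ψ N N‖)
      (fun q ψ => by positivity) (fun q => inferInstance)
    have hbound : ∑ χ : DirichletCharacter ℂ q,
        ((N : ℝ) + N / P)⁻¹ * ‖gallagherTerm χ.primitiveCharacter N N‖ ≤ C * E := by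
      refine hemb.trans ?_
      convert hA' using 2
    have hsum : ∑ χ : DirichletCharacter ℂ q, ‖gallagherTerm χ.primitiveCharacter N N‖ =
        ((N : ℝ) + N / P) * ∑ χ : DirichletCharacter ℂ q,
          ((N : ℝ) + N / P)⁻¹ * ‖gallagherTerm χ.primitiveCharacter N N‖ := by
      rw [Finset.mul_sum]
      refine Finset.sum_congr rfl fun χ _ => ?_
      rw [← mul_assoc, mul_inv_cancel₀ hNP.ne', one_mul]
    rw [hsum]
    have hCE : 0 ≤ max C 1 * E := mul_nonneg (le_trans zero_le_one (le_max_right C 1)) hE0.le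
    calc ((N : ℝ) + N / P) * _ ≤ ((N : ℝ) + N / P) * (C * E) :=
          mul_le_mul_of_nonneg_left hbound hNP.le
      _ ≤ ((N : ℝ) + N / P) * (max C 1 * E) :=
          mul_le_mul_of_nonneg_left (mul_le_mul_of_nonneg_right hC hE0.le) hNP.le
      _ ≤ (2 * N) * (max C 1 * E) := mul_le_mul_of_nonneg_right hNP2 hCE
      _ = 2 * N * max C 1 * E := by ring

/-! ### The identity behind `θ(N; q, a)` -/

open scoped Classical in
/-- **`φ(q) θ(N; q, a)` through the characters, with the exceptional correction**: for a unit `a`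
of `ZMod q`, a character `χ̃` mod `r` and a real `β`,
`φ(q) θ(N; q, a) ≥ N − r' S_β − ∑_χ ‖∑#̃ χ⋆‖ − φ(q) log q`, where
`∑#̃ χ⋆ = gallagherTermExc χ̃ β χ⋆ N N`, `S_β = ∑_{n ≤ N} n^{β−1}` and
`r' = Re ∑_{χ mod q induced by χ̃} χ(a⁻¹)` (orthogonality; `∑_{p≤N} χ(p) log p` differs from
`∑_{p ≤ N} χ⋆(p) log p` by at most `log q`, `PrimesInAPGallagher.norm_sub_charPrimeSum_le`).
[cite: Gallagher1970Density, Theorem 7 (deduction of primes in progressions)] -/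
theorem totient_mul_theta_ge_exc {q : ℕ} [NeZero q] {a : ZMod q} (ha : IsUnit a) (N : ℕ)
    {r : ℕ} (χe : DirichletCharacter ℂ r) (β : ℝ) :
    (N : ℝ) - (∑ χ ∈ (univ : Finset (DirichletCharacter ℂ q)).filter (fun χ =>
            χ.conductor = r ∧ ∀ n : ℕ, χ.primitiveCharacter (n : ZMod χ.conductor) = χe (n : ZMod r)),
            χ a⁻¹).re * ∑ n ∈ Ioc 0 N, (n : ℝ) ^ (β - 1)
        - ∑ χ : DirichletCharacter ℂ q, ‖gallagherTermExc χe β χ.primitiveCharacter N N‖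
        - q.totient * Real.log q ≤
      q.totient * ∑ p ∈ ((Ioc 0 N).filter Nat.Prime).filter (fun p : ℕ => (p : ZMod q) = a),
        Real.log p := by
  have hZ := sum_char_inv_mul_sum_eq ha N
  have hw1 : ∀ χ : DirichletCharacter ℂ q, ‖χ a⁻¹‖ ≤ 1 := fun χ => DirichletCharacter.norm_le_one χ _
  -- the decomposition of `∑_{p ≤ N} χ(p) log p`
  have hgt : ∀ χ : DirichletCharacter ℂ q, gallagherTerm χ.primitiveCharacter N N =
      charPrimeSum χ.primitiveCharacter N N - if χ = 1 then (N : ℂ) else 0 := by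
    intro χ
    rw [gallagherTerm, Nat.sub_self, Nat.card_Ioc, Nat.sub_zero]
    congr 1
    by_cases h : χ = 1
    · rw [if_pos h, if_pos (DirichletCharacter.eq_one_iff_conductor_eq_one.mp h)]
    · rw [if_neg h, if_neg (fun h' => h (DirichletCharacter.eq_one_iff_conductor_eq_one.mpr h'))]
  have hdec : ∀ χ : DirichletCharacter ℂ q,
      χ a⁻¹ * ∑ p ∈ (Ioc 0 N).filter Nat.Prime, χ (p : ZMod q) * (Real.log p : ℂ) =
      χ a⁻¹ * gallagherTermExc χe β χ.primitiveCharacter N N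
        + χ a⁻¹ * (if χ = 1 then (N : ℂ) else 0)
        - χ a⁻¹ * (if (χ.conductor = r ∧ ∀ n : ℕ,
              χ.primitiveCharacter (n : ZMod χ.conductor) = χe (n : ZMod r))
            then ((∑ n ∈ Ioc 0 N, (n : ℝ) ^ (β - 1) : ℝ) : ℂ) else 0)
        + χ a⁻¹ * (∑ p ∈ (Ioc 0 N).filter Nat.Prime, χ (p : ZMod q) * (Real.log p : ℂ) -
            charPrimeSum χ.primitiveCharacter N N) := by
    intro χ
    have h1 : gallagherTermExc χe β χ.primitiveCharacter N N =
        gallagherTerm χ.primitiveCharacter N N + if (χ.conductor = r ∧ ∀ n : ℕ,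
              χ.primitiveCharacter (n : ZMod χ.conductor) = χe (n : ZMod r))
            then ((∑ n ∈ Ioc 0 N, (n : ℝ) ^ (β - 1) : ℝ) : ℂ) else 0 := by
      rw [gallagherTermExc, Nat.sub_self]
    rw [h1, hgt χ]
    ring
  have hainv : IsUnit a⁻¹ := by
    obtain ⟨u, hu⟩ := ha
    rw [← hu, ZMod.inv_coe_unit]
    exact Units.isUnit _
  have hone : ∑ χ : DirichletCharacter ℂ q, χ a⁻¹ * (if χ = 1 then (N : ℂ) else 0) = N := by
    rw [Finset.sum_eq_single (1 : DirichletCharacter ℂ q)]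
    · rw [if_pos rfl, MulChar.one_apply hainv, one_mul]
    · intro χ _ hχ; rw [if_neg hχ, mul_zero]
    · intro h; exact absurd (Finset.mem_univ _) h
  have hcondsum : ∑ χ : DirichletCharacter ℂ q, χ a⁻¹ * (if (χ.conductor = r ∧ ∀ n : ℕ,
              χ.primitiveCharacter (n : ZMod χ.conductor) = χe (n : ZMod r))
            then ((∑ n ∈ Ioc 0 N, (n : ℝ) ^ (β - 1) : ℝ) : ℂ) else 0) =
      (∑ χ ∈ (univ : Finset (DirichletCharacter ℂ q)).filter (fun χ =>
            χ.conductor = r ∧ ∀ n : ℕ, χ.primitiveCharacter (n : ZMod χ.conductor) = χe (n : ZMod r)),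
          χ a⁻¹) * ((∑ n ∈ Ioc 0 N, (n : ℝ) ^ (β - 1) : ℝ) : ℂ) := by
    rw [Finset.sum_mul, Finset.sum_filter]
    refine Finset.sum_congr rfl fun χ _ => ?_
    split_ifs <;> simp
  -- the identity
  have hsum : (q.totient : ℂ) * ((∑ p ∈ ((Ioc 0 N).filter Nat.Prime).filter
        (fun p : ℕ => (p : ZMod q) = a), Real.log p : ℝ) : ℂ) =
      ∑ χ : DirichletCharacter ℂ q, χ a⁻¹ * gallagherTermExc χe β χ.primitiveCharacter N N + N
        - (∑ χ ∈ (univ : Finset (DirichletCharacter ℂ q)).filter (fun χ =>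
            χ.conductor = r ∧ ∀ n : ℕ, χ.primitiveCharacter (n : ZMod χ.conductor) = χe (n : ZMod r)),
          χ a⁻¹) * ((∑ n ∈ Ioc 0 N, (n : ℝ) ^ (β - 1) : ℝ) : ℂ)
        + ∑ χ : DirichletCharacter ℂ q, χ a⁻¹ *
            (∑ p ∈ (Ioc 0 N).filter Nat.Prime, χ (p : ZMod q) * (Real.log p : ℂ) -
              charPrimeSum χ.primitiveCharacter N N) := by
    rw [← hZ, Finset.sum_congr rfl (fun χ _ => hdec χ), Finset.sum_add_distrib,
      Finset.sum_sub_distrib, Finset.sum_add_distrib, hone, hcondsum]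
  have hre : (q.totient : ℝ) * (∑ p ∈ ((Ioc 0 N).filter Nat.Prime).filter
        (fun p : ℕ => (p : ZMod q) = a), Real.log p : ℝ) =
      (∑ χ : DirichletCharacter ℂ q, χ a⁻¹ * gallagherTermExc χe β χ.primitiveCharacter N N).re + N
        - (∑ χ ∈ (univ : Finset (DirichletCharacter ℂ q)).filter (fun χ =>
            χ.conductor = r ∧ ∀ n : ℕ, χ.primitiveCharacter (n : ZMod χ.conductor) = χe (n : ZMod r)),
          χ a⁻¹).re * (∑ n ∈ Ioc 0 N, (n : ℝ) ^ (β - 1))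
        + (∑ χ : DirichletCharacter ℂ q, χ a⁻¹ *
            (∑ p ∈ (Ioc 0 N).filter Nat.Prime, χ (p : ZMod q) * (Real.log p : ℂ) -
              charPrimeSum χ.primitiveCharacter N N)).re := by
    have := congrArg Complex.re hsum
    simpa only [Complex.add_re, Complex.sub_re, Complex.natCast_re, Complex.re_mul_ofReal] using this
  -- bounds
  have hcardq : (Finset.univ : Finset (DirichletCharacter ℂ q)).card = q.totient := by
    rw [Finset.card_univ, ← Nat.card_eq_fintype_card,
      DirichletCharacter.card_eq_totient_of_hasEnoughRootsOfUnity]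
  have hb1 : -(∑ χ : DirichletCharacter ℂ q, ‖gallagherTermExc χe β χ.primitiveCharacter N N‖) ≤
      (∑ χ : DirichletCharacter ℂ q, χ a⁻¹ * gallagherTermExc χe β χ.primitiveCharacter N N).re := by
    have h1 := Complex.abs_re_le_norm
      (∑ χ : DirichletCharacter ℂ q, χ a⁻¹ * gallagherTermExc χe β χ.primitiveCharacter N N)
    have h2 := norm_sum_le (Finset.univ : Finset (DirichletCharacter ℂ q))
      (fun χ => χ a⁻¹ * gallagherTermExc χe β χ.primitiveCharacter N N)
    have h3 : ∑ χ : DirichletCharacter ℂ q, ‖χ a⁻¹ * gallagherTermExc χe β χ.primitiveCharacter N N‖ ≤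
        ∑ χ : DirichletCharacter ℂ q, ‖gallagherTermExc χe β χ.primitiveCharacter N N‖ := by
      refine Finset.sum_le_sum fun χ _ => ?_
      rw [norm_mul]
      exact mul_le_of_le_one_left (norm_nonneg _) (hw1 χ)
    have := neg_abs_le (∑ χ : DirichletCharacter ℂ q,
      χ a⁻¹ * gallagherTermExc χe β χ.primitiveCharacter N N).re
    linarith
  have hb2 : -((q.totient : ℝ) * Real.log q) ≤ (∑ χ : DirichletCharacter ℂ q, χ a⁻¹ *
      (∑ p ∈ (Ioc 0 N).filter Nat.Prime, χ (p : ZMod q) * (Real.log p : ℂ) -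
        charPrimeSum χ.primitiveCharacter N N)).re := by
    have h1 := Complex.abs_re_le_norm (∑ χ : DirichletCharacter ℂ q, χ a⁻¹ *
      (∑ p ∈ (Ioc 0 N).filter Nat.Prime, χ (p : ZMod q) * (Real.log p : ℂ) -
        charPrimeSum χ.primitiveCharacter N N))
    have h2 := norm_sum_le (Finset.univ : Finset (DirichletCharacter ℂ q)) (fun χ => χ a⁻¹ *
      (∑ p ∈ (Ioc 0 N).filter Nat.Prime, χ (p : ZMod q) * (Real.log p : ℂ) -
        charPrimeSum χ.primitiveCharacter N N))
    have h3 : ∑ χ : DirichletCharacter ℂ q, ‖χ a⁻¹ *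
        (∑ p ∈ (Ioc 0 N).filter Nat.Prime, χ (p : ZMod q) * (Real.log p : ℂ) -
          charPrimeSum χ.primitiveCharacter N N)‖ ≤ q.totient * Real.log q := by
      have := Finset.sum_le_card_nsmul (Finset.univ : Finset (DirichletCharacter ℂ q))
        (fun χ => ‖χ a⁻¹ * (∑ p ∈ (Ioc 0 N).filter Nat.Prime, χ (p : ZMod q) * (Real.log p : ℂ) -
          charPrimeSum χ.primitiveCharacter N N)‖) (Real.log q) (fun χ _ => by
          rw [norm_mul]
          exact (mul_le_of_le_one_left (norm_nonneg _) (hw1 χ)).trans (norm_sub_charPrimeSum_le χ N))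
      rwa [hcardq, nsmul_eq_mul] at this
    have := neg_abs_le (∑ χ : DirichletCharacter ℂ q, χ a⁻¹ *
      (∑ p ∈ (Ioc 0 N).filter Nat.Prime, χ (p : ZMod q) * (Real.log p : ℂ) -
        charPrimeSum χ.primitiveCharacter N N)).re
    linarith
  linarith

open scoped Classical in
/-- The coefficient `r' = Re ∑_{χ mod q induced by χ̃} χ(a⁻¹)` of the exceptional correction has
`|r'| ≤ 1` (at most one character is induced by `χ̃`, `card_filter_inducedBy_le_one`, and
`|χ(a⁻¹)| ≤ 1`). [folklore] -/
theorem abs_re_sum_inducedBy_le_one {q : ℕ} [NeZero q] (a : ZMod q) {r : ℕ}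
    (χe : DirichletCharacter ℂ r) :
    |(∑ χ ∈ (univ : Finset (DirichletCharacter ℂ q)).filter (fun χ =>
        χ.conductor = r ∧ ∀ n : ℕ, χ.primitiveCharacter (n : ZMod χ.conductor) = χe (n : ZMod r)),
        χ a⁻¹).re| ≤ 1 := by
  have hcard := card_filter_inducedBy_le_one (q := q) χe inferInstance
  refine (Complex.abs_re_le_norm _).trans ((norm_sum_le _ _).trans ?_)
  refine (Finset.sum_le_sum fun χ _ => DirichletCharacter.norm_le_one χ a⁻¹).trans ?_
  rw [Finset.sum_const, nsmul_eq_mul, mul_one]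
  exact_mod_cast hcard

open scoped Classical in
/-- Without exceptional character (formally: `r = 0`, no conductor vanishes) the correction is
absent: the coefficient is `0` and `∑#̃ = ∑#`. [folklore] -/
theorem sum_inducedBy_zero_eq_zero {q : ℕ} [NeZero q] (a : ZMod q)
    (χe : DirichletCharacter ℂ 0) :
    (∑ χ ∈ (univ : Finset (DirichletCharacter ℂ q)).filter (fun χ =>
        χ.conductor = 0 ∧ ∀ n : ℕ, χ.primitiveCharacter (n : ZMod χ.conductor) = χe (n : ZMod 0)),
        χ a⁻¹) = 0 := by
  refine Finset.sum_eq_zero fun χ hχ => ?_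
  rw [Finset.mem_filter] at hχ
  exact absurd hχ.2.1 χ.conductor_ne_zero

open scoped Classical in
/-- `gallagherTermExc` with the vacuous exceptional datum of modulus `0` is `gallagherTerm`.
[folklore] -/
theorem gallagherTermExc_zero_eq {q : ℕ} [NeZero q] (χe : DirichletCharacter ℂ 0) (β : ℝ)
    (χ : DirichletCharacter ℂ q) (x h : ℕ) :
    gallagherTermExc χe β χ.primitiveCharacter x h = gallagherTerm χ.primitiveCharacter x h := by
  rw [gallagherTermExc, if_neg, add_zero]
  rintro ⟨hcond, -⟩
  exact χ.conductor_ne_zero hcond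

/-! ### Positivity of `θ(N; q, a)` in the Linnik range -/

set_option maxHeartbeats 400000 in
open scoped Classical in
/-- **`θ(N; q, a) > 0` for `P ≥ max(q, P₀)`, `P^A ≤ N ≤ 2P^A`**, from `lemma43_gallagher`: there are
`A ≥ 1` and `P₀ ≥ 1` such that for every `q ≥ 1`, every unit `a` mod `q`, every `P ≥ P₀` with
`q ≤ P` and every natural `N` with `P^A ≤ N ≤ 2 P^A`, `∑_{p ≤ N prime, p ≡ a (q)} log p > 0`.
[cite: Linnik1944] [cite: Bombieri1987GrandCrible, §6, Preuve du Théorème de Linnik] -/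
theorem theta_pos_of_lemma43 (h43 : lemma43_gallagher) :
    ∃ A : ℝ, 1 ≤ A ∧ ∃ P₀ : ℝ, 1 ≤ P₀ ∧ ∀ (q : ℕ) [NeZero q] (a : ZMod q), IsUnit a →
      ∀ P : ℝ, P₀ ≤ P → (q : ℝ) ≤ P → ∀ N : ℕ, P ^ A ≤ (N : ℝ) → (N : ℝ) ≤ 2 * P ^ A →
        0 < ∑ p ∈ ((Ioc 0 N).filter Nat.Prime).filter (fun p : ℕ => (p : ZMod q) = a),
          Real.log p := by
  obtain ⟨c₁, hc₁, c₃, hc₃, c₄, hc₄, K, hK, hGal⟩ := sum_norm_gallagherTerm_le_or h43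
  obtain ⟨cU, hcU, hU⟩ := exists_exceptionalZero_unique
  obtain ⟨C_S, hC_S, hSiegel⟩ := Siegel.exists_one_sub_realZero_ge (ε := (1 : ℝ)) one_pos
  -- constants
  set c₁' : ℝ := max c₁ 1 with hc₁'
  have hc₁'1 : 1 ≤ c₁' := le_max_right _ _
  have hc₁c₁' : c₁ ≤ c₁' := le_max_left _ _
  have hK0 : 0 < K := by linarith
  set A : ℝ := max (max 4 (1 / c₄)) (Real.log (32 * K * c₁') / c₃ + 1) with hA
  have hA4 : 4 ≤ A := (le_max_left _ _).trans' (le_max_left _ _)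
  have hAc₄ : 1 / c₄ ≤ A := (le_max_left _ _).trans' (le_max_right _ _)
  have hAK : Real.log (32 * K * c₁') / c₃ ≤ A := by
    have := le_max_right (max 4 (1 / c₄)) (Real.log (32 * K * c₁') / c₃ + 1); linarith
  have hA1 : 1 ≤ A := by linarith
  set C' : ℝ := min C_S cU with hC'
  have hC'0 : 0 < C' := lt_min hC_S hcU
  have hC'S : C' ≤ C_S := min_le_left _ _
  have hC'U : C' ≤ cU := min_le_right _ _
  set P₀ : ℝ := max (max (Real.exp (A + 1)) (Real.exp (4 * c₁' + 16)))
    (64 / (C' * Real.log 2) + 16) with hP₀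
  have hP₀exp : Real.exp (A + 1) ≤ P₀ := (le_max_left _ _).trans' (le_max_left _ _)
  have hP₀c : Real.exp (4 * c₁' + 16) ≤ P₀ := (le_max_left _ _).trans' (le_max_right _ _)
  have hP₀C : 64 / (C' * Real.log 2) + 16 ≤ P₀ := le_max_right _ _
  have hP₀16 : 16 ≤ P₀ := by
    have : 0 ≤ 64 / (C' * Real.log 2) := by positivity
    linarith
  have hP₀1 : 1 ≤ P₀ := by linarith
  refine ⟨A, hA1, P₀, hP₀1, fun q _ a ha P hP hqP N hN1 hN2 => ?_⟩
  -- sizes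
  have hP16 : 16 ≤ P := hP₀16.trans hP
  have hP1 : 1 < P := by linarith
  have hP0 : 0 < P := by linarith
  have hlogP : 0 < Real.log P := Real.log_pos hP1
  have hlog2 : 0 < Real.log 2 := Real.log_pos (by norm_num)
  have hlogP2 : Real.log 2 ≤ Real.log P := Real.log_le_log (by norm_num) (by linarith)
  have hlogPA : A + 1 ≤ Real.log P := by
    rw [← Real.log_exp (A + 1)]; exact Real.log_le_log (Real.exp_pos _) (hP₀exp.trans hP)
  have hlogPc : 4 * c₁' + 16 ≤ Real.log P := by
    rw [← Real.log_exp (4 * c₁' + 16)]; exact Real.log_le_log (Real.exp_pos _) (hP₀c.trans hP)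
  have hlogPP : Real.log P ≤ P := (Real.log_le_sub_one_of_pos hP0).trans (by linarith)
  have hPA1 : 1 ≤ P ^ A := Real.one_le_rpow hP1.le (by linarith)
  have hN1' : (1 : ℝ) ≤ N := hPA1.trans hN1
  have hN0 : (0 : ℝ) < N := by linarith
  have hNnat : 1 ≤ N := by exact_mod_cast hN1'
  have hlogN : A * Real.log P ≤ Real.log N := by
    rw [← Real.log_rpow hP0]; exact Real.log_le_log (by positivity) hN1
  have hlogN' : Real.log N ≤ (A + 1) * Real.log P := by
    calc Real.log N ≤ Real.log (2 * P ^ A) := Real.log_le_log hN0 hN2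
      _ = Real.log 2 + A * Real.log P := by
          rw [Real.log_mul (by norm_num) (by positivity), Real.log_rpow hP0]
      _ ≤ (A + 1) * Real.log P := by linarith
  have hlogN16 : 16 ≤ Real.log N := by
    have := mul_le_mul_of_nonneg_right hA1 hlogP.le
    linarith
  have hN1lt : (1 : ℝ) < N := by
    by_contra h
    have : Real.log N ≤ 0 := Real.log_nonpos hN0.le (not_lt.mp h)
    linarith
  -- the range of Lemma 4.3
  have hrange1 : Real.exp (Real.sqrt (Real.log N)) ≤ P := by
    rw [← Real.exp_log hP0, Real.exp_le_exp]
    refine Real.sqrt_le_iff.mpr ⟨hlogP.le, ?_⟩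
    have := mul_le_mul_of_nonneg_right hlogPA hlogP.le
    rw [sq]; linarith
  have hrange2 : P ≤ (N : ℝ) ^ c₄ := by
    have h1 : P ≤ (P ^ A) ^ c₄ := by
      rw [← Real.rpow_mul hP0.le]
      have : 1 ≤ A * c₄ := by
        rw [div_le_iff₀ hc₄] at hAc₄; linarith
      calc P = P ^ (1 : ℝ) := (Real.rpow_one P).symm
        _ ≤ P ^ (A * c₄) := Real.rpow_le_rpow_of_exponent_le hP1.le this
    exact h1.trans (Real.rpow_le_rpow (by positivity) hN1 hc₄.le)
  -- `E ≤ e^{−c₃ A} ≤ 1/(32 K c₁')`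
  set E : ℝ := Real.exp (-c₃ * Real.log N / Real.log P) with hE
  have hE0 : 0 < E := Real.exp_pos _
  have hEK : E * (32 * K * c₁') ≤ 1 := by
    have h1 : E ≤ Real.exp (-c₃ * A) := by
      rw [hE, Real.exp_le_exp]
      have : c₃ * A ≤ c₃ * Real.log N / Real.log P := by
        rw [le_div_iff₀ hlogP]
        have := mul_le_mul_of_nonneg_left hlogN hc₃.le
        linarith
      have e : -c₃ * Real.log N / Real.log P = -(c₃ * Real.log N / Real.log P) := by ring
      linarith
    have h2 : Real.exp (-c₃ * A) * (32 * K * c₁') ≤ 1 := by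
      have h3 : Real.log (32 * K * c₁') ≤ c₃ * A := by rw [div_le_iff₀ hc₃] at hAK; linarith
      have h4 : 32 * K * c₁' ≤ Real.exp (c₃ * A) := by
        calc 32 * K * c₁' = Real.exp (Real.log (32 * K * c₁')) := (Real.exp_log (by positivity)).symm
          _ ≤ Real.exp (c₃ * A) := Real.exp_le_exp.mpr h3
      have h5 : Real.exp (-c₃ * A) * Real.exp (c₃ * A) = 1 := by
        rw [← Real.exp_add]; simp
      calc Real.exp (-c₃ * A) * (32 * K * c₁') ≤ Real.exp (-c₃ * A) * Real.exp (c₃ * A) :=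
            mul_le_mul_of_nonneg_left h4 (Real.exp_pos _).le
        _ = 1 := h5
    exact (mul_le_mul_of_nonneg_right h1 (by positivity)).trans h2
  -- `φ(q) log q ≤ P²` and `16 P² ≤ N`
  have hφ : (q.totient : ℝ) * Real.log q ≤ P ^ 2 := by
    have hq1 : (1 : ℝ) ≤ q := by exact_mod_cast Nat.pos_of_neZero q
    have h1 : (q.totient : ℝ) ≤ q := by exact_mod_cast Nat.totient_le q
    have h2 : Real.log q ≤ q := (Real.log_le_sub_one_of_pos (by linarith)).trans (by linarith)
    have h3 : Real.log q ≥ 0 := Real.log_nonneg hq1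
    calc (q.totient : ℝ) * Real.log q ≤ q * q := mul_le_mul h1 h2 h3 (by linarith)
      _ ≤ P * P := mul_le_mul hqP hqP (by linarith) hP0.le
      _ = P ^ 2 := by ring
  have hP2N : 16 * P ^ 2 ≤ N := by
    have h1 : 16 * P ^ 2 ≤ P ^ (3 : ℝ) := by
      rw [show (3 : ℝ) = (3 : ℕ) by norm_num, Real.rpow_natCast]
      have := mul_le_mul_of_nonneg_right hP16 (sq_nonneg P)
      calc 16 * P ^ 2 ≤ P * P ^ 2 := this
        _ = P ^ 3 := by ring
    have h2 : P ^ (3 : ℝ) ≤ P ^ A := Real.rpow_le_rpow_of_exponent_le hP1.le (by linarith)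
    linarith
  have hP2 : (256 : ℝ) ≤ P ^ 2 := by
    have := mul_le_mul hP16 hP16 (by norm_num) (by linarith)
    calc (256 : ℝ) = 16 * 16 := by norm_num
      _ ≤ P * P := this
      _ = P ^ 2 := by ring
  -- the theorem
  have hφ0 : (0 : ℝ) < q.totient := by exact_mod_cast Nat.totient_pos.mpr (Nat.pos_of_neZero q)
  refine pos_of_mul_pos_right (a := (q.totient : ℝ)) ?_ hφ0.le
  rcases hGal N P hNnat hrange1 hrange2 hP1.le q hqP with ⟨-, hAsum⟩ | ⟨r, hr, χe, β, hexc, hBsum⟩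
  · -- no exceptional zero
    have hθ := totient_mul_theta_ge_exc ha N (r := 0) (1 : DirichletCharacter ℂ 0) 1
    rw [sum_inducedBy_zero_eq_zero a (1 : DirichletCharacter ℂ 0), Complex.zero_re, zero_mul,
      sub_zero] at hθ
    simp only [gallagherTermExc_zero_eq] at hθ
    have h1 : ∑ χ : DirichletCharacter ℂ q, ‖gallagherTerm χ.primitiveCharacter N N‖ ≤ N / 16 := by
      refine hAsum.trans ?_
      have : 2 * (N : ℝ) * K * E = (N / 16) * (E * (32 * K * 1)) := by ring
      rw [this]
      have hE1 : E * (32 * K * 1) ≤ 1 :=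
        le_trans (mul_le_mul_of_nonneg_left (by nlinarith) hE0.le) hEK
      exact mul_le_of_le_one_right (by positivity) hE1
    linarith only [hθ, h1, hφ, hP2N, hP2, hN0]
  · -- the exceptional zero `β` of `χ̃` mod `r` occurs
    haveI := hr
    obtain ⟨hprim, hne1, hrP, hβlow, hβ1, hLβ⟩ := hexc
    have hθ := totient_mul_theta_ge_exc ha N χe β
    have hr' := abs_re_sum_inducedBy_le_one a χe
    obtain ⟨r', hr'def⟩ : ∃ r' : ℝ, r' = (∑ χ ∈ (univ : Finset (DirichletCharacter ℂ q)).filter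
        (fun χ => χ.conductor = r ∧
          ∀ n : ℕ, χ.primitiveCharacter (n : ZMod χ.conductor) = χe (n : ZMod r)), χ a⁻¹).re :=
      ⟨_, rfl⟩
    obtain ⟨Sβ, hSβ⟩ : ∃ S : ℝ, S = ∑ n ∈ Ioc 0 N, (n : ℝ) ^ (β - 1) := ⟨_, rfl⟩
    rw [← hr'def, ← hSβ] at hθ
    rw [← hr'def] at hr'
    -- `3/4 ≤ β < 1`, `0 < 1 − β`
    have hβ34 : 3 / 4 ≤ β := by
      have h1 : c₁ / Real.log P ≤ 1 / 4 := by
        rw [div_le_iff₀ hlogP]; linarith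
      linarith
    have hβ0 : 0 < β := by linarith
    have hδ0 : 0 < 1 - β := by linarith
    have hδc₁ : (1 - β) * Real.log P ≤ c₁' := by
      have h1 : 1 - β ≤ c₁ / Real.log P := by linarith
      calc (1 - β) * Real.log P ≤ c₁ / Real.log P * Real.log P :=
            mul_le_mul_of_nonneg_right h1 hlogP.le
        _ = c₁ := div_mul_cancel₀ c₁ hlogP.ne'
        _ ≤ c₁' := hc₁c₁'
    -- the lower bound `1 − β ≥ C'/P` (Landau–Page: `χ̃` quadratic, then Siegel; or `β` far from `1`)
    have hδlow : C' / P ≤ 1 - β := by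
      by_cases hβU : 1 - cU / Real.log P < β
      · have hsq : χe ^ 2 = 1 :=
          ((hU P (by linarith)).1 r χe hne1 hrP (β : ℂ) hLβ
            (by rw [Complex.ofReal_im, abs_zero]; linarith) (by rw [Complex.ofReal_re]; exact hβU)).1
        have hS := hSiegel r χe hsq hne1 β hLβ
        have hr1 : (1 : ℝ) ≤ r := by exact_mod_cast Nat.pos_of_neZero r
        rw [Real.rpow_neg (by linarith), Real.rpow_one] at hS
        calc C' / P ≤ C_S / P := div_le_div_of_nonneg_right hC'S hP0.le
          _ ≤ C_S / r := div_le_div_of_nonneg_left hC_S.le (by linarith) hrP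
          _ = C_S * (r : ℝ)⁻¹ := div_eq_mul_inv _ _
          _ ≤ 1 - β := hS
      · push Not at hβU
        calc C' / P ≤ cU / P := div_le_div_of_nonneg_right hC'U hP0.le
          _ ≤ cU / Real.log P := div_le_div_of_nonneg_left hcU.le hlogP hlogPP
          _ ≤ 1 - β := by linarith
    -- the main term
    have hS : |Sβ - (N : ℝ) ^ β / β| ≤ 1 / β := hSβ ▸ abs_sum_rpow_sub_div_le hNnat hβ0 hβ1.le
    have hmainβ := sub_mul_rpow_div_ge (r := r') hN1lt (by linarith) hβ34 hβ1 hr'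
    have h43 : 1 / β ≤ 4 / 3 := by rw [div_le_div_iff₀ hβ0 (by norm_num)]; linarith
    have hmain : (N : ℝ) / 4 * min 1 ((1 - β) * Real.log N) - 4 / 3 ≤ N - r' * Sβ := by
      have h1 : |r' * (Sβ - (N : ℝ) ^ β / β)| ≤ 4 / 3 := by
        rw [abs_mul]
        calc |r'| * |Sβ - (N : ℝ) ^ β / β| ≤ 1 * (1 / β) := mul_le_mul hr' hS (abs_nonneg _) zero_le_one
          _ ≤ 4 / 3 := by linarith
      have h2 := (abs_le.mp h1).2
      have e : (N : ℝ) - r' * Sβ = (N - r' * (N : ℝ) ^ β / β) - r' * (Sβ - (N : ℝ) ^ β / β) := by ring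
      rw [e]; linarith
    -- the error from Lemma 4.3
    have hc₁'0 : c₁' ≠ 0 := by positivity
    have herr : ∑ χ : DirichletCharacter ℂ q, ‖gallagherTermExc χe β χ.primitiveCharacter N N‖ ≤
        N / 16 * ((1 - β) * Real.log P) / c₁' := by
      refine hBsum.trans ?_
      have e : 2 * (N : ℝ) * K * ((1 - β) * Real.log P) * E =
          N / 16 * ((1 - β) * Real.log P) / c₁' * (E * (32 * K * c₁')) := by
        field_simp; ring
      rw [e]
      exact mul_le_of_le_one_right (by positivity) hEK
    rcases le_or_gt 1 ((1 - β) * Real.log N) with hB1 | hB2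
    · -- `(1 − β) log N ≥ 1`: main term `≥ N/4`
      rw [min_eq_left hB1, mul_one] at hmain
      have herr' : ∑ χ : DirichletCharacter ℂ q, ‖gallagherTermExc χe β χ.primitiveCharacter N N‖ ≤
          N / 16 := by
        refine herr.trans ?_
        rw [div_le_iff₀ (by positivity)]
        exact mul_le_mul_of_nonneg_left hδc₁ (by positivity)
      linarith only [hθ, hmain, herr', hφ, hP2N, hP2]
    · -- `(1 − β) log N < 1`: main term `≥ (N/4)(1 − β) A log P`
      rw [min_eq_right hB2.le] at hmain
      set X : ℝ := (1 - β) * Real.log P with hX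
      have hX0 : 0 < X := mul_pos hδ0 hlogP
      have hmain' : (N : ℝ) / 4 * (A * X) - 4 / 3 ≤ N - r' * Sβ := by
        have : (N : ℝ) / 4 * (A * X) ≤ N / 4 * ((1 - β) * Real.log N) := by
          refine mul_le_mul_of_nonneg_left ?_ (by positivity)
          rw [hX]
          have := mul_le_mul_of_nonneg_left hlogN hδ0.le
          linarith only [this]
        linarith only [this, hmain]
      have herr' : ∑ χ : DirichletCharacter ℂ q, ‖gallagherTermExc χe β χ.primitiveCharacter N N‖ ≤
          N / 16 * (A * X) := by
        refine herr.trans ?_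
        have h1 : (N : ℝ) / 16 * X / c₁' ≤ N / 16 * X := div_le_self (by positivity) hc₁'1
        have h2 : (N : ℝ) / 16 * X ≤ N / 16 * (A * X) :=
          mul_le_mul_of_nonneg_left (le_mul_of_one_le_left hX0.le hA1) (by positivity)
        exact h1.trans h2
      -- `P² + 4/3 ≤ (N/16) A X` from `1 − β ≥ C'/P`, `N ≥ P^A ≥ P⁴`, `P ≥ 64/(C' log 2)`
      have hkey : P ^ 2 + 4 / 3 ≤ (N : ℝ) / 16 * (A * X) := by
        have hX1 : C' * Real.log 2 / P ≤ X := by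
          rw [hX]
          calc C' * Real.log 2 / P = C' / P * Real.log 2 := by ring
            _ ≤ (1 - β) * Real.log P := mul_le_mul hδlow hlogP2 hlog2.le hδ0.le
        have hN4 : P ^ 4 ≤ (N : ℝ) := by
          have : P ^ (4 : ℝ) ≤ P ^ A := Real.rpow_le_rpow_of_exponent_le hP1.le hA4
          rw [show (4 : ℝ) = (4 : ℕ) by norm_num, Real.rpow_natCast] at this
          exact this.trans hN1
        have hPC : 64 / (C' * Real.log 2) ≤ P := by linarith
        have hPC' : 64 ≤ P * (C' * Real.log 2) := by
          rwa [div_le_iff₀ (by positivity)] at hPC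
        -- `N A X ≥ P⁴ · (C' log 2/P) = P² · (P C' log 2) ≥ 64 P² ≥ 16 (P² + 4/3)`
        have hc0 : 0 ≤ C' * Real.log 2 / P := div_nonneg (mul_nonneg hC'0.le hlog2.le) hP0.le
        have hX2 : C' * Real.log 2 / P ≤ A * X := hX1.trans (le_mul_of_one_le_left hX0.le hA1)
        have h1 : P ^ 4 * (C' * Real.log 2 / P) ≤ (N : ℝ) * (A * X) := mul_le_mul hN4 hX2 hc0 hN0.le
        have h2 : P ^ 4 * (C' * Real.log 2 / P) = P ^ 2 * (P * (C' * Real.log 2)) := by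
          field_simp
        rw [h2] at h1
        have h3 : P ^ 2 * 64 ≤ P ^ 2 * (P * (C' * Real.log 2)) :=
          mul_le_mul_of_nonneg_left hPC' (sq_nonneg P)
        linarith only [h1, h3, hP2]
      linarith only [hθ, hmain', herr', hφ, hkey, hP2]

/-! ### Linnik's theorem -/

/-- **Linnik's theorem from Lemma 4.3, real constants**: assuming `lemma43_gallagher`, there are
`L, C > 0` such that for every `q ≥ 1` and every `a` coprime to `q` there is a prime `p ≡ a (mod q)`
with `p ≤ C q^L` (`P = max(q, P₀)`, `N = ⌈P^A⌉`, `θ(N; q, a) > 0`). [cite: Linnik1944] -/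
theorem exists_prime_le_of_lemma43 (h43 : lemma43_gallagher) :
    ∃ L C : ℝ, 0 < L ∧ 0 < C ∧ ∀ q : ℕ, 1 ≤ q → ∀ a : ℕ, a.Coprime q →
      ∃ p : ℕ, p.Prime ∧ p ≡ a [MOD q] ∧ (p : ℝ) ≤ C * (q : ℝ) ^ L := by
  classical
  obtain ⟨A, hA1, P₀, hP₀1, h⟩ := theta_pos_of_lemma43 h43
  refine ⟨A, 2 * P₀ ^ A, by linarith, by positivity, fun q hq a haq => ?_⟩
  haveI : NeZero q := ⟨by omega⟩
  have ha : IsUnit (a : ZMod q) := (ZMod.isUnit_iff_coprime a q).mpr haq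
  set P : ℝ := max (q : ℝ) P₀ with hP
  have hP0 : 0 < P := lt_of_lt_of_le (by linarith) (le_max_right _ _)
  have hPA : 1 ≤ P ^ A := Real.one_le_rpow ((le_max_right _ _).trans' hP₀1) (by linarith)
  set N : ℕ := ⌈P ^ A⌉₊ with hN
  have hN1 : P ^ A ≤ (N : ℝ) := Nat.le_ceil _
  have hN2 : (N : ℝ) ≤ 2 * P ^ A := by
    have := Nat.ceil_lt_add_one (show 0 ≤ P ^ A by positivity)
    rw [← hN] at this; linarith
  have hpos := h q (a : ZMod q) ha P (le_max_right _ _) (le_max_left _ _) N hN1 hN2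
  have hne : (((Ioc 0 N).filter Nat.Prime).filter (fun p : ℕ => (p : ZMod q) = a)).Nonempty := by
    by_contra hemp
    rw [Finset.not_nonempty_iff_eq_empty] at hemp
    rw [hemp, Finset.sum_empty] at hpos
    exact lt_irrefl _ hpos
  obtain ⟨p, hp⟩ := hne
  simp only [Finset.mem_filter, Finset.mem_Ioc] at hp
  obtain ⟨⟨⟨-, hpN⟩, hpprime⟩, hpa⟩ := hp
  refine ⟨p, hpprime, (ZMod.natCast_eq_natCast_iff _ _ _).mp hpa, ?_⟩
  have hq1 : (1 : ℝ) ≤ q := by exact_mod_cast hq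
  have hPle : P ≤ (q : ℝ) * P₀ := by
    rcases le_total (q : ℝ) P₀ with hle | hle
    · rw [hP, max_eq_right hle]; exact le_mul_of_one_le_left (by linarith) hq1
    · rw [hP, max_eq_left hle]; exact le_mul_of_one_le_right (by linarith) hP₀1
  calc (p : ℝ) ≤ N := by exact_mod_cast hpN
    _ ≤ 2 * P ^ A := hN2
    _ ≤ 2 * ((q : ℝ) * P₀) ^ A := by
        refine mul_le_mul_of_nonneg_left (Real.rpow_le_rpow hP0.le hPle (by linarith)) (by norm_num)
    _ = 2 * P₀ ^ A * (q : ℝ) ^ A := by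
        rw [Real.mul_rpow (by linarith) (by linarith)]; ring

/-- **Linnik's theorem from Lemma 4.3, natural constants** (the shape of the displayed hypothesis
`hLin` of `Summits/ABC/…/EisensteinQuarantineFalseOfProthDepthFamily.lean`). [cite: Linnik1944] -/
theorem linnik_of_lemma43 (h43 : lemma43_gallagher) :
    ∃ L C : ℕ, ∀ q : ℕ, 1 ≤ q → ∀ a : ℕ, Nat.Coprime a q →
      ∃ p : ℕ, p.Prime ∧ p ≡ a [MOD q] ∧ p ≤ C * q ^ L := by
  obtain ⟨L, C, -, hC, h⟩ := exists_prime_le_of_lemma43 h43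
  refine ⟨⌈L⌉₊, ⌈C⌉₊, fun q hq a ha => ?_⟩
  obtain ⟨p, hp, hmod, hle⟩ := h q hq a ha
  refine ⟨p, hp, hmod, ?_⟩
  have hq1 : (1 : ℝ) ≤ q := by exact_mod_cast hq
  have h1 : (q : ℝ) ^ L ≤ (q : ℝ) ^ (⌈L⌉₊ : ℝ) :=
    Real.rpow_le_rpow_of_exponent_le hq1 (Nat.le_ceil L)
  rw [Real.rpow_natCast] at h1
  have h2 : C * (q : ℝ) ^ L ≤ (⌈C⌉₊ : ℝ) * (q : ℝ) ^ ⌈L⌉₊ :=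
    mul_le_mul (Nat.le_ceil C) h1 (by positivity) (by positivity)
  exact_mod_cast hle.trans h2

end Linnik

open MontgomeryVaughan1975 in
/-- **LINNIK'S THEOREM** (Linnik 1944), unconditional: there are natural constants `L, C` such that
for every `q ≥ 1` and every `a` coprime to `q` there is a prime `p ≡ a (mod q)` with `p ≤ C q^L`.
All inputs are theorems of the tree: Gallagher's prime number theorem `lemma43_gallagher_holds`
(explicit formulae, Bombieri's log-free zero-density theorem, the Deuring–Heilbronn phenomenon,
Landau–Page), and Siegel's theorem for the size of the exceptional zero. [cite: Linnik1944]
[cite: Bombieri1987GrandCrible, §6, Preuve du Théorème de Linnik] -/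
theorem linnik_leastPrimeAP :
    ∃ L C : ℕ, ∀ q : ℕ, 1 ≤ q → ∀ a : ℕ, Nat.Coprime a q →
      ∃ p : ℕ, p.Prime ∧ p ≡ a [MOD q] ∧ p ≤ C * q ^ L :=
  Linnik.linnik_of_lemma43 lemma43_gallagher_holds

open MontgomeryVaughan1975 in
/-- **Linnik's theorem, real constants**: `∃ L, C > 0`, for all `q ≥ 1` and `a` coprime to `q`
some prime `p ≡ a (mod q)` has `p ≤ C q^L`. [cite: Linnik1944] -/
theorem linnik_leastPrimeAP_real :
    ∃ L C : ℝ, 0 < L ∧ 0 < C ∧ ∀ q : ℕ, 1 ≤ q → ∀ a : ℕ, a.Coprime q →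
      ∃ p : ℕ, p.Prime ∧ p ≡ a [MOD q] ∧ (p : ℝ) ≤ C * (q : ℝ) ^ L :=
  Linnik.exists_prime_le_of_lemma43 lemma43_gallagher_holds

end Literature.NumberTheory.Sieve

end
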